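import Summits.QuantumFields.YangMills.Theorems.BalabanUVNodesN07RecordCrownSUPrecomp
import Literature.MathematicalPhysics.QuantumFieldTheory.Balaban1983to89.Node00.TorusCoverCubeMemberRecordDentZd
import HarnessLib

/-!
# N07 [B11] (= [15] = [Balaban1985Variational]) Sect. F — **THE φ-ADAPTER «PRE-COMPOSED RECORD CROWN (`SU(N)`) → `DatumCrownPhiAt` AT THE DENTED PRINT DATUM, EVERY ADMISSIBLE
# COLLAR»**: `RecordCrownSUPrecompBody F.L N B₀ c₁ ρ₀ M₀ N₀ R₀ → ∀ Mc, ∃ s ρmin, ∀ ρ₀′ (ρmin ∣ ρ₀′), DatumCrownPhiAt F N Mc (ρ₀′·L) hρ s (560L³B₀M′) (20LB₀) (c₁∕(56L²M′)) (c₁∕2)`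

Cell `pub-ymgap`, width seat `pub-ymgap-dag-n07-w3` g13 (junction side of the K0 road).  `--kind definition --supports stmt-QuantumFields-20541 --as helper` (K0⁷; count-neutral).
ONE `def` (a displayed premise SHAPE — NEVER asserted) + theorems.  No `instance`, no `notation`, no `sorry`.
[6] = [Balaban1985RegularSpaces]; [15] = [Balaban1985Variational]; [3] = [Balaban1985Averaging]; [I] = [Balaban1987RG1].

WHY.  The φ-twin of ✓p735717 (`datumCrownAt_of_recordCrownSUBody`): under A3⁵ ∕ №312a (β) the junction reads the PRE-COMPOSED record crown (dag-n05-e g42 F8, socket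
`RecordCrownSUPrecompBody` — INTENT-4) at the DENTED print datum `recordCubePZ … Dtop` (✓p749305; ⚑ LOCATED-TOP-DENT, Q1 = YES: the chart reads row 9′ at the dent pairs, so the (1.29)
cells must be the dented tower's, [15] (148)–(150) as printed).  THIS FILE names the shape the knit consumes — `DatumCrownPhiAt F N Mc ρ hρ s Cr Cω α₁ ω₁` = ✓p721358's `DatumCrownAt`
with (i) the datum `recordCubePZ (F.P K) j hj hjK Mc ρ hρ idx Dtop` (top dent `Dtop`, e.g. `(domainsOfSeq s.Ω j hk).Om j`), (ii) F8's pre-composition binders `h ∈ SU(N)`, cell data `X`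
with `hconst`, oscillation letter `0 ≤ ω ≤ ω₁` with F8's two oscillation rows — all PASSED THROUGH (the knit chooses `X := R̄^{j′}(g_sr)`, builds `h` by ✓p748893
`exists_blockConstant_dented_mem`, and pays the rows from N07's θ-letters), (iii) the R8 dent premise for the dented top `dentFamZ … j = □̃ᶻ ∩ liftTopZ …` at the crown's exponent `s`
DISPLAYED per datum (it holds iff the run's top region is a union of the crown's `L^{s+1}·Lʲ`-superblocks — Q2′ on the cell bus: `L^{s+1} ∣ M·R_j`; `s` is therefore EXPOSED, returned by
the adapter together with the collar modulus), (iv) the rows at the transformation `h⁻¹·u₀` with the two-slope radius `Cr·α + Cω·ω` (`5dLB₀·(7dL²M′α + ω) = 560L³B₀M′·α + 20LB₀·ω`),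
clause 3 `Restr129Z … 1 u₀` EXACT for the Theorem-4 output — and proves the adapter from the socket: side conditions and `(s, ρmin)` from ✓p732355 `exists_collar_sideConditions`, the
guard `7·4·L²·M′·α + ω ≤ c₁` from `α ≤ c₁∕(56L²M′)`, `ω ≤ c₁∕2`.

WHAT IS DECLARED ∕ PROVED (kernel; axioms standard).
* §1 `DatumCrownPhiAt F N Mc ρ hρ s Cr Cω α₁ ω₁ : Prop` — displayed, NEVER asserted; `guard_phi`, `radius_phi` (arithmetic).
* §2 ★★★ `datumCrownPhiAt_of_recordCrownSUPrecompBody` — THE φ-ADAPTER (statement in the title).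
HONEST FRAMING: count-neutral; composition by name + bookkeeping; `RecordCrownSUPrecompBody` is inhabited for `N ≤ 25` by INTENT-4's `recordCrownSUPrecomp_holds_of_le` (n05-e F8); the
dent premise inside `DatumCrownPhiAt` is DISPLAYED (Q2′), the oscillation rows and the cell data are the knit's (open: (σ1) `Cond167Z` export for `u₀`, (σ2) sym-tower (167) —
HOME `pub-ymgap-dag-n07-w3/JUNCTION-PHI-ROAD.md`); the φ-row and the knit `hThm4RecSym152PhiE_of_datumCrownPhiAt` are NOT here; nothing of [3]∕[6]∕[15]∕[I] asserted;
`HThm4RecSym152Phi(E)` ∕ `HThm4Rec*` UNDISCHARGED; N05 ∕ N07 NOT discharged; K0⁷ ∕ K1⁹ NOT closed; counts unmoved (typed 28∕28 · discharged 8∕28); one finite 𝕋⁴ programme at fixed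
ε — R4 closes the conditional finite-𝕋⁴ rung `BalabanLadder.UV` ONLY; the YM mass gap (Clay) is NOT proved by any of this; nothing continuum ∕ ℝ⁴ ∕ OS.

References: [6] Thm. 4 p. 88, Prop. 6 (1.130)–(1.138) pp. 98–99, (1.29) p. 81, (1.4) p. 77; [15] (144) p. 300, (147)–(153) p. 301; [3] (78)–(81) p. 30; [I] (0.3)–(0.6) pp. 252–253.
-/

set_option autoImplicit false

noncomputable section

open scoped BigOperators Matrix.Norms.L2Operator

namespace Summit.QuantumFields.YangMills.BalabanUVNodes.N07DatumCrownPhiOfRecordCrownPrecomp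

open Literature.MathematicalPhysics.QuantumFieldTheory.Balaban1983to89
open Literature.MathematicalPhysics.QuantumFieldTheory.Balaban1983to89.Node00
open Literature.MathematicalPhysics.QuantumLattice (blockMap)
open B15Eq112TorusCover (cover)
open B14DomainGeom (Pt)
open B8Eq131Cubes (tLo tHi)
open B8Eq131CubesRec (tcubeZ bLoZ bHiZ)
open B7Prop1Explicit (e gaugeAct)
open B7Prop1Local (AgreeOn InBox)
open B7Prop2SpecialUnitary (specialUnitaryUnits)
open BlockAveragingZd (avgIterZ ctrShift)
open B8Ineq132 (covDerivFwd InAk)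
open B8Eq140Level (SideTouches)
open B8Eq138LandauZd (logCfg covLap)
open B8Eq138LandauZdRec (IsLandau138WZ)
open B8Eq119TwistedAxialRec (Restr129Z UnderZ)
open B7SectEFLinearisationRec (logCovIterZ)
open B8Eq184Proof (cfgExp)
open B8ScaledSupNorm (msup bondNorm)
open B8Eq146AExpansion (plaqCovDeriv iEta)
open B8Eq143PlaqExpansion (pdiv)
open B7AvgGaugeCovariance (uLev)
open MatrixLog (mlog)
open T4Continuum (T4Family)
open N07RecordCrownSUPrecomp (RecordCrownSUPrecompBody RecordCrownSUPrecomp)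
open N07DatumCrownSideConditions (exists_collar_sideConditions ιSU_mem_specialUnitaryUnits sideP_P_eq)

variable (F : T4Family) (N : ℕ) [NeZero N]

/-! ## §1  The displayed premise at the dented datum: `DatumCrownPhiAt` -/

/-- **`DatumCrownPhiAt F N Mc ρ hρ s Cr Cω α₁ ω₁` — THE PRE-COMPOSED RECORD CROWN AT THE DENTED PRINT DATUM** (✓p721358's `DatumCrownAt`, φ-edition): for every `K`, every `SU(N)` field
`U` on `F.P K`, every datum `(j, idx)` (`1 ≤ j ≤ m + K`) and every top dent `Dtop ⊆ T^{(j)}` whose anchored lift is saturated for the crown's `L^{s+1}·Lʲ`-superblocks (the R8 dent premise,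
DISPLAYED), every tolerance `0 < α ≤ α₁` with the top-anchored lift in `𝔄_j(dentFamZ, α)`, every `SU(N)`-valued pre-composition `h` constant `= X(j′, y)` on the block tower under each (1.29)-cell
of `recordCubePZ … Dtop`, every oscillation letter `0 ≤ ω ≤ ω₁` bounding `h`'s level readings across the (1.35) bonds and the level-`0` collar: a Theorem-4 output `u₀` (`SU(N)`-valued, `= 1`
off `Ω′₀`, (1.29)-normalised EXACTLY on the dented cells) with the crown's rows for the representative `((U₀″)^h)^{u₀⁻¹}` at radius `Cr·α + Cω·ω` and (1.137) for the pre-composed axial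
representative.  A displayed predicate, NEVER asserted. [cite: Balaban1985RegularSpaces, Thm. 4 p.88, Prop. 6 (1.130)–(1.138) p.99, (1.29) p.81; Balaban1985Variational, (144) p.300, (147)–(153) p.301; Balaban1987RG1, (0.3)–(0.6) pp.252–253] -/
def DatumCrownPhiAt (Mc ρ : ℕ) (hρ : F.L ≤ ρ) (s : ℕ) (Cr Cω α₁ ω₁ : ℝ) : Prop :=
  ∀ (K : ℕ) (U : GaugeField (F.P K) 0 (SU N)) (j : ℕ) (hj : 1 ≤ j) (hjK : j ≤ (F.P K).m + (F.P K).K) (idx : Pt (F.P K).d) (Dtop : Finset (Site (F.P K) j)),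
    letI : CStarAlgebra (MatA N) := {};
    -- the R8 dent premise for the dented top at exponent `s` (DISPLAYED; Q2′)
    (∀ x y : B7Prop1Explicit.Site (F.P K).d,
        blockMap (F.L ^ (s + 1) * F.L ^ j) (x - fun i => (F.L : ℤ) ^ j * (cornerP (F.P K) Mc ρ idx i - ρ) - (ctrShift F.L j : ℤ)) =
          blockMap (F.L ^ (s + 1) * F.L ^ j) (y - fun i => (F.L : ℤ) ^ j * (cornerP (F.P K) Mc ρ idx i - ρ) - (ctrShift F.L j : ℤ)) →
        x ∈ dentFamZ (F.P K) j Mc ρ idx Dtop j → y ∈ dentFamZ (F.P K) j Mc ρ idx Dtop j) →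
    ∀ (α : ℝ), 0 < α → α ≤ α₁ →
    InAk (F.P K).L j ((F.P K).eta j) α (dentFamZ (F.P K) j Mc ρ idx Dtop)
        (fun x μ => ιSU N (U ⟨cover (F.P K) (x + fun _ => (ctrShift (F.P K).L j : ℤ)), μ⟩)) →
    ∀ (h : B7Prop1Explicit.Site (F.P K).d → (MatA N)ˣ), (∀ x, h x ∈ specialUnitaryUnits (Fin N)) →
    ∀ (X : ℕ → B7Prop1Explicit.Site (F.P K).d → (MatA N)ˣ),
    (∀ j', 1 ≤ j' → j' ≤ j → ∀ y ∈ (recordCubePZ (F.P K) j hj hjK Mc ρ hρ idx Dtop).lamS j', ∀ x, UnderZ (F.P K).L j' y x → h x = X j' y) →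
    ∀ (ω : ℝ), 0 ≤ ω → ω ≤ ω₁ →
    (∀ j', j' ≤ j → ∀ (z : B7Prop1Explicit.Site (F.P K).d) (μ : Fin (F.P K).d),
      (∀ x, InBox (fun i => ((F.P K).L : ℤ) ^ j' * z i - (ctrShift (F.P K).L j' : ℤ))
          (fun i => ((F.P K).L : ℤ) ^ j' * z i + (ctrShift (F.P K).L j' : ℤ) + if i = μ then ((F.P K).L : ℤ) ^ j' else 0) x →
        x ∈ (recordCubePZ (F.P K) j hj hjK Mc ρ hρ idx Dtop).sq (j' - 1)) →
      ‖((uLev (F.P K).L h j' z : (MatA N)ˣ) : MatA N) - ((uLev (F.P K).L h j' (z + e μ) : (MatA N)ˣ) : MatA N)‖ ≤ ω) →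
    (∀ b ∈ {b : B7Prop1Explicit.Site (F.P K).d × Fin (F.P K).d | SideTouches ((recordCubePZ (F.P K) j hj hjK Mc ρ hρ idx Dtop).sq 0) b.1 b.2},
      ‖((h b.1 : (MatA N)ˣ) : MatA N) - ((h (b.1 + e b.2) : (MatA N)ˣ) : MatA N)‖ ≤ ω) →
    ∃ u : B7Prop1Explicit.Site (F.P K).d → (MatA N)ˣ, (∀ x, u x ∈ specialUnitaryUnits (Fin N)) ∧
      (∀ x, x ∉ (recordCubePZ (F.P K) j hj hjK Mc ρ hρ idx Dtop).sq 0 → u x = 1) ∧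
      Restr129Z (F.P K).L j (recordCubePZ (F.P K) j hj hjK Mc ρ hρ idx Dtop).lamS (1 : B7Prop1Explicit.Site (F.P K).d → Fin (F.P K).d → (MatA N)ˣ) u ∧
      IsLandau138WZ (F.P K).L j ((F.P K).eta j) ((recordCubePZ (F.P K) j hj hjK Mc ρ hρ idx Dtop).sq 0) (recordCubePZ (F.P K) j hj hjK Mc ρ hρ idx Dtop).lamS
        (1 : B7Prop1Explicit.Site (F.P K).d → Fin (F.P K).d → (MatA N)ˣ)
        ((recordCubePZ (F.P K) j hj hjK Mc ρ hρ idx Dtop).fixed (fun x μ => ιSU N (U ⟨cover (F.P K) (x + fun _ => (ctrShift (F.P K).L j : ℤ)), μ⟩)) (h⁻¹ * u)) ∧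
      (∀ j', j' ≤ j → ∀ b ∈ {b : B7Prop1Explicit.Site (F.P K).d × Fin (F.P K).d | SideTouches ((recordCubePZ (F.P K) j hj hjK Mc ρ hρ idx Dtop).sq j') b.1 b.2},
        (recordCubePZ (F.P K) j hj hjK Mc ρ hρ idx Dtop).fixed (fun x μ => ιSU N (U ⟨cover (F.P K) (x + fun _ => (ctrShift (F.P K).L j : ℤ)), μ⟩)) (h⁻¹ * u) b.1 b.2 =
            cfgExp ((F.P K).eta j) (logCfg ((F.P K).eta j) ((recordCubePZ (F.P K) j hj hjK Mc ρ hρ idx Dtop).fixed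
              (fun x μ => ιSU N (U ⟨cover (F.P K) (x + fun _ => (ctrShift (F.P K).L j : ℤ)), μ⟩)) (h⁻¹ * u))) b.1 b.2 ∧
          IsSelfAdjoint (logCfg ((F.P K).eta j) ((recordCubePZ (F.P K) j hj hjK Mc ρ hρ idx Dtop).fixed
              (fun x μ => ιSU N (U ⟨cover (F.P K) (x + fun _ => (ctrShift (F.P K).L j : ℤ)), μ⟩)) (h⁻¹ * u)) b.1 b.2) ∧
          ‖logCfg ((F.P K).eta j) ((recordCubePZ (F.P K) j hj hjK Mc ρ hρ idx Dtop).fixed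
              (fun x μ => ιSU N (U ⟨cover (F.P K) (x + fun _ => (ctrShift (F.P K).L j : ℤ)), μ⟩)) (h⁻¹ * u)) b.1 b.2‖ ≤
            (Cr * α + Cω * ω) * (((F.P K).L : ℝ) ^ j' * (F.P K).eta j)⁻¹) ∧
      (∀ x, (((recordCubePZ (F.P K) j hj hjK Mc ρ hρ idx Dtop).vfix (fun x μ => ιSU N (U ⟨cover (F.P K) (x + fun _ => (ctrShift (F.P K).L j : ℤ)), μ⟩)))⁻¹ * (h⁻¹ * u)) x ∈
        specialUnitaryUnits (Fin N)) ∧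
      AgreeOn (B8Ineq130Rec.tlo (F.P K).L (tLo (cornerP (F.P K) Mc ρ idx) ρ) j) (B8Ineq130Rec.thi (F.P K).L (tHi (cornerP (F.P K) Mc ρ idx) (sideP (F.P K) Mc ρ) ρ) j)
        (gaugeAct (((recordCubePZ (F.P K) j hj hjK Mc ρ hρ idx Dtop).vfix (fun x μ => ιSU N (U ⟨cover (F.P K) (x + fun _ => (ctrShift (F.P K).L j : ℤ)), μ⟩)))⁻¹ * (h⁻¹ * u))⁻¹
          (fun x μ => ιSU N (U ⟨cover (F.P K) (x + fun _ => (ctrShift (F.P K).L j : ℤ)), μ⟩)))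
        ((recordCubePZ (F.P K) j hj hjK Mc ρ hρ idx Dtop).fixed (fun x μ => ιSU N (U ⟨cover (F.P K) (x + fun _ => (ctrShift (F.P K).L j : ℤ)), μ⟩)) (h⁻¹ * u)) ∧
      msup (F.P K).L j ((F.P K).eta j) (-(2 : ℝ))
          (fun j' (q : Fin (F.P K).d × Fin (F.P K).d × B7Prop1Explicit.Site (F.P K).d) => SideTouches ((recordCubePZ (F.P K) j hj hjK Mc ρ hρ idx Dtop).sq j') q.2.2 q.2.1)
          (fun q => covDerivFwd ((F.P K).eta j) (1 : B7Prop1Explicit.Site (F.P K).d → Fin (F.P K).d → (MatA N)ˣ) q.1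
            (fun z => (recordCubePZ (F.P K) j hj hjK Mc ρ hρ idx Dtop).expo ((F.P K).eta j)
              (fun x μ => ιSU N (U ⟨cover (F.P K) (x + fun _ => (ctrShift (F.P K).L j : ℤ)), μ⟩)) (h⁻¹ * u) z q.2.1) q.2.2) ≤ Cr * α + Cω * ω ∧
      bondNorm (F.P K).L j ((F.P K).eta j) (-(3 : ℝ)) (recordCubePZ (F.P K) j hj hjK Mc ρ hρ idx Dtop).sq
          (fun x μ => pdiv ((F.P K).eta j) (1 : B7Prop1Explicit.Site (F.P K).d → Fin (F.P K).d → (MatA N)ˣ)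
            (plaqCovDeriv ((F.P K).eta j) (1 : B7Prop1Explicit.Site (F.P K).d → Fin (F.P K).d → (MatA N)ˣ)
              ((recordCubePZ (F.P K) j hj hjK Mc ρ hρ idx Dtop).expo ((F.P K).eta j)
                (fun x μ => ιSU N (U ⟨cover (F.P K) (x + fun _ => (ctrShift (F.P K).L j : ℤ)), μ⟩)) (h⁻¹ * u))) μ x) ≤ Cr * α + Cω * ω ∧
      bondNorm (F.P K).L j ((F.P K).eta j) (-(3 : ℝ)) (recordCubePZ (F.P K) j hj hjK Mc ρ hρ idx Dtop).sq
          (fun x μ => covLap ((F.P K).eta j) (1 : B7Prop1Explicit.Site (F.P K).d → Fin (F.P K).d → (MatA N)ˣ)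
            (fun z => (recordCubePZ (F.P K) j hj hjK Mc ρ hρ idx Dtop).expo ((F.P K).eta j)
              (fun x μ => ιSU N (U ⟨cover (F.P K) (x + fun _ => (ctrShift (F.P K).L j : ℤ)), μ⟩)) (h⁻¹ * u) z μ) x) ≤ Cr * α + Cω * ω ∧
      (∀ (x : B7Prop1Explicit.Site (F.P K).d) (μ : Fin (F.P K).d),
        bLoZ (F.P K).L (cornerP (F.P K) Mc ρ idx) 0 0 ≤ x → x + e μ ≤ bHiZ (F.P K).L (cornerP (F.P K) Mc ρ idx) (sideP (F.P K) Mc ρ) 0 0 →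
        (recordCubePZ (F.P K) j hj hjK Mc ρ hρ idx Dtop).inTop x → (recordCubePZ (F.P K) j hj hjK Mc ρ hρ idx Dtop).inTop (x + e μ) →
        logCovIterZ (F.P K).L (1 : B7Prop1Explicit.Site (F.P K).d → Fin (F.P K).d → (MatA N)ˣ)
            (iEta ((F.P K).eta j) ((recordCubePZ (F.P K) j hj hjK Mc ρ hρ idx Dtop).expo ((F.P K).eta j)
              (fun x μ => ιSU N (U ⟨cover (F.P K) (x + fun _ => (ctrShift (F.P K).L j : ℤ)), μ⟩)) (h⁻¹ * u))) j x μ =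
          mlog ((avgIterZ (F.P K).L (gaugeAct h ((recordCubePZ (F.P K) j hj hjK Mc ρ hρ idx Dtop).axial
            (fun x μ => ιSU N (U ⟨cover (F.P K) (x + fun _ => (ctrShift (F.P K).L j : ℤ)), μ⟩)))) j x μ : (MatA N)ˣ) : MatA N))

variable {F N}

/-- **THE GUARD, φ-edition**: `α ≤ c₁∕(56·L²·M′)` and `ω ≤ c₁∕2` give the pre-composed crown's threshold `7·4·L²·M′·α + ω ≤ c₁` (`M′ = sideP (F.P 0) Mc ρ ≥ 1`).
[cite: Balaban1985RegularSpaces, Prop. 6 p.99 («for α₀ sufficiently small»), (1.130) p.99] -/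
theorem guard_phi {Mc ρ : ℕ} (hρ : F.L ≤ ρ) {c₁ α ω : ℝ}
    (hα : α ≤ c₁ / (56 * (F.L : ℝ) ^ 2 * (sideP (F.P 0) Mc ρ : ℝ))) (hω : ω ≤ c₁ / 2) :
    7 * ((4 : ℕ) : ℝ) * (F.L : ℝ) ^ 2 * (sideP (F.P 0) Mc ρ : ℝ) * α + ω ≤ c₁ := by
  have hL : (1 : ℝ) ≤ F.L := by exact_mod_cast (F.P 0).L_pos
  have hρ0 : 0 < ρ := lt_of_lt_of_le (F.P 0).L_pos (by rw [T4Family.P_L]; exact hρ)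
  have hM : (1 : ℝ) ≤ sideP (F.P 0) Mc ρ := by
    have h := le_sideP (P := F.P 0) Mc hρ0
    exact_mod_cast (show 1 ≤ sideP (F.P 0) Mc ρ by omega)
  have hD : 0 < 56 * (F.L : ℝ) ^ 2 * (sideP (F.P 0) Mc ρ : ℝ) := by positivity
  have h56 : 56 * (F.L : ℝ) ^ 2 * (sideP (F.P 0) Mc ρ : ℝ) * α ≤ c₁ := by
    have := mul_le_mul_of_nonneg_left hα hD.le
    rwa [mul_div_cancel₀ _ hD.ne'] at this
  push_cast
  nlinarith [h56, hω]

/-- **THE RADIUS, φ-edition**: `5·4·L·B₀·(7·4·L²·M′·α + ω) = (560·L³·B₀·M′)·α + (20·L·B₀)·ω`. [cite: Balaban1985RegularSpaces, Prop. 6 (1.135)–(1.136) p.99 (bookkeeping)] -/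
theorem radius_phi (L M' B₀ α ω : ℝ) :
    5 * ((4 : ℕ) : ℝ) * L * B₀ * (7 * ((4 : ℕ) : ℝ) * L ^ 2 * M' * α + ω) = (560 * L ^ 3 * B₀ * M') * α + (20 * L * B₀) * ω := by
  push_cast; ring

variable (F N)

/-! ## §2  The φ-adapter -/

omit [NeZero N] in
/-- ★★★ **THE φ-ADAPTER «PRE-COMPOSED RECORD CROWN (`SU(N)` edition) → `DatumCrownPhiAt` AT THE DENTED PRINT DATUM, EVERY ADMISSIBLE COLLAR»**: from
`RecordCrownSUPrecompBody F.L N B₀ c₁ ρ₀ M₀ N₀ R₀`, for every grid side `Mc` there are the crown exponent `s` and a collar modulus `ρmin ≥ 1` such that at every collar `ρ := ρ₀′·L`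
with `ρmin ∣ ρ₀′`, `ρ₀′ ≥ 1`: `DatumCrownPhiAt F N Mc ρ hρ s (560·L³·B₀·M′) (20·L·B₀) (c₁∕(56·L²·M′)) (c₁∕2)`, `M′ = sideP (F.P 0) Mc ρ`.  Proof: ✓p735717's adapter VERBATIM at the datum
`recordCubePZ (F.P K) j hj hjK Mc ρ hρ idx Dtop` with the pre-composition binders and the dent premise passed through; side conditions from `exists_collar_sideConditions`; guard
`guard_phi`; radius `radius_phi`. [cite: Balaban1985RegularSpaces, Prop. 6 (1.130), (1.135)–(1.138) pp.98–99, (1.29) p.81, (1.4) p.77; Balaban1985Variational, (144) p.300, (148)–(153) p.301; Balaban1987RG1, (0.3)–(0.6) pp.252–253] -/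
theorem datumCrownPhiAt_of_recordCrownSUPrecompBody {B₀ c₁ ρ₀ M₀ : ℝ} {N₀ R₀ : ℕ} (h : RecordCrownSUPrecompBody F.L N B₀ c₁ ρ₀ M₀ N₀ R₀) (Mc : ℕ) :
    ∃ s ρmin : ℕ, 1 ≤ ρmin ∧ ∀ ρ₀' : ℕ, ρmin ∣ ρ₀' → 1 ≤ ρ₀' → ∀ hρ : F.L ≤ ρ₀' * F.L,
      DatumCrownPhiAt F N Mc (ρ₀' * F.L) hρ s (560 * (F.L : ℝ) ^ 3 * B₀ * (sideP (F.P 0) Mc (ρ₀' * F.L) : ℝ)) (20 * (F.L : ℝ) * B₀)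
        (c₁ / (56 * (F.L : ℝ) ^ 2 * (sideP (F.P 0) Mc (ρ₀' * F.L) : ℝ))) (c₁ / 2) := by
  have hL3 : 3 ≤ (F.P 0).L := by have := F.hL11; rw [T4Family.P_L]; omega
  obtain ⟨s, ρmin, hρmin, H⟩ := exists_collar_sideConditions (F.P 0) hL3 ρ₀ M₀ N₀ R₀
  refine ⟨s, ρmin, hρmin, fun ρ₀' hdvd hρ1 hρ => ?_⟩
  obtain ⟨R, h3, hM0, hdivρ, hdivM, hRρ, h2L, hR0, hN0, hρ0⟩ := H ρ₀' hdvd hρ1 Mc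
  intro K U j hj hjK idx Dtop hdent α hα hα₁ hA hh hhSU X hconst ω hω hω₁ hoscj hosc0
  letI : CStarAlgebra (MatA N) := {}
  have hη : 0 < (F.P K).eta j := B3GkZeroTorusRescaled.eta_pos (F.P K) j
  have hρK : (F.P K).L ≤ ρ₀' * F.L := by rw [T4Family.P_L]; exact hρ
  have hU₀ : ∀ (x : B7Prop1Explicit.Site (F.P K).d) (κ : Fin (F.P K).d),
      (fun x μ => ιSU N (U ⟨cover (F.P K) (x + fun _ => (ctrShift (F.P K).L j : ℤ)), μ⟩)) x κ ∈ specialUnitaryUnits (Fin N) :=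
    fun _ _ => ιSU_mem_specialUnitaryUnits N _
  -- the guard in the crown's letters (`c.M = sideP (F.P K) Mc ρ = sideP (F.P 0) Mc ρ`, `L := F.L`)
  have hguard : 7 * ((4 : ℕ) : ℝ) * (F.L : ℝ) ^ 2 * ((recordCubePZ (F.P K) j hj hjK Mc (ρ₀' * F.L) hρK idx Dtop).M : ℝ) * α + ω ≤ c₁ := by
    rw [recordCubePZ_M, sideP_P_eq]
    exact guard_phi (F := F) hρ hα₁ hω₁
  obtain ⟨u, h1, h2, h3', h4, h5, h6, h7, h8, h9, h10, h11⟩ :=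
    h ((F.P K).eta j) hη (recordCubePZ (F.P K) j hj hjK Mc (ρ₀' * F.L) hρK idx Dtop) s R h3 hM0 hdivρ
      (by rw [recordCubePZ_M, sideP_P_eq]; exact hdivM) hRρ h2L hR0 hN0 (by rw [recordCubePZ_ρ]; exact hρ0)
      hdent _ hU₀ α hα hA hh hhSU X hconst ω hω hoscj hosc0 hguard
  refine ⟨u, h1, h2, h3', h4, ?_, h6, h7, ?_, ?_, ?_, h11⟩
  · intro j' hj' b hb
    obtain ⟨e1, e2, e3⟩ := h5 j' hj' b hb
    refine ⟨e1, e2, e3.trans_eq ?_⟩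
    rw [recordCubePZ_M, sideP_P_eq, T4Family.P_L, radius_phi]
  · rw [recordCubePZ_M, sideP_P_eq, T4Family.P_L, radius_phi] at h8; exact h8
  · rw [recordCubePZ_M, sideP_P_eq, T4Family.P_L, radius_phi] at h9; exact h9
  · rw [recordCubePZ_M, sideP_P_eq, T4Family.P_L, radius_phi] at h10; exact h10

end Summit.QuantumFields.YangMills.BalabanUVNodes.N07DatumCrownPhiOfRecordCrownPrecomp

end
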